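import Mathlib
import Summits.NavierStokesRegularity.NavierStokesRegularity.Theses.AdiabaticEddy
import Literature.Analysis.FluidPDE.AxisymmetricEuler
import Literature.Analysis.FluidPDE.GavrilovSteadyEuler

/-!
# Crux `CorrectorSolvable` (stmt-NavierStokesRegularity-1429) — ideator 2 sketch (crux-ideate round 1)

Signatures only (`sorry` allowed here; nothing in this file is proposed to the tree).

* `CorrectorData` — the matrix of the crux; `correctorSolvable_iff` checks it is literally the crux.
* `rotField`, `killing_cokernel_pointwise` — FIRST LEMMA of the negative note
  `barrier-axisym-nogo.md` (§2, identity (2.1)): the rotation Killing field weighted by any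
  function of the swirl lies in the (formal) cokernel of the linearised steady Euler operator
  wherever `U·∇Γ = 0`.
* `corrector_swirl_balance` — the necessary condition (★) forces on axisymmetric profiles.
* `NoAxisymmetricCorrector` — the target negative lemma (proved in the note for tame collars),
  and `correctorSolvable_witness_not_axisymmetric` — what it leaves of the crux.
* `NonAxisymmetricCompactEuler`, `KillingFreeCorrector` — FIRST LEMMA / transfer target of the
  idea card `killing-free-collar`.
-/

noncomputable section

open scoped RealInnerProductSpace
open MeasureTheory

namespace Summit.NavierStokesRegularity.NavierStokesRegularity.Cruxes.CorrectorSolvable.Ideator2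

open Literature.Analysis.FluidPDE

local notation "ℝ³" => EuclideanSpace ℝ (Fin 3)

/-- The matrix of the crux: `(U, W, P, q, a, b, c)` is a corrector datum. -/
def CorrectorData (U W : ℝ³ → ℝ³) (P q : ℝ³ → ℝ) (a b : ℝ) (c : ℝ³) : Prop :=
  ContDiff ℝ (⊤ : ℕ∞) U ∧ ContDiff ℝ (⊤ : ℕ∞) P ∧ HasCompactSupport U ∧ U ≠ 0 ∧
  VectorCalculus.IsDivFree U ∧ (∀ x, convect U U x + gradient P x = 0) ∧
  ContDiff ℝ (⊤ : ℕ∞) W ∧ ContDiff ℝ (⊤ : ℕ∞) q ∧ VectorCalculus.IsDivFree W ∧ b < 0 ∧ 0 < a + b ∧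
  ∀ y, convect U W y + convect W U y + gradient q y =
    Laplacian.laplacian U y - a • U y + b • (fderiv ℝ U y) y + (fderiv ℝ U y) c

/-- The crux is literally `∃ data, CorrectorData data`. -/
theorem correctorSolvable_iff :
    Theses.AdiabaticEddy.CorrectorSolvable ↔
      ∃ (U W : ℝ³ → ℝ³) (P q : ℝ³ → ℝ) (a b : ℝ) (c : ℝ³), CorrectorData U W P q a b c :=
  Iff.rfl

/-- The corrector right-hand side `F = ΔU − aU + b(y·∇)U + (c·∇)U`. -/
def correctorRHS (U : ℝ³ → ℝ³) (a b : ℝ) (c : ℝ³) (y : ℝ³) : ℝ³ :=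
  Laplacian.laplacian U y - a • U y + b • (fderiv ℝ U y) y + (fderiv ℝ U y) c

/-- The rotation Killing field about the `x 2`-axis, `R x = e_z × x = (−x₁, x₀, 0)`. -/
def rotField (x : ℝ³) : ℝ³ := cross eZ x

/-- `Γ = ⟪R, U⟫`: the tree's `swirl` is the pairing with the Killing field. (calculus, provable now) -/
theorem swirl_eq_inner_rotField (u : ℝ³ → ℝ³) (x : ℝ³) : swirl u x = ⟪rotField x, u x⟫ := by
  sorry

/-- FIRST LEMMA (negative note §2, identity (2.1); sympy-checked in kit job j016754, part A):
at any point where the swirl is transported (`U·∇Γ = 0`), the field `V_g = g(Γ)·R` satisfies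
`−(U·∇)V_g + (∇U)ᵀ V_g = g(Γ) ∇Γ` — i.e. it is annihilated, up to a gradient, by the formal adjoint
of `W ↦ U·∇W + W·∇U`. Pure `fderiv` calculus. -/
theorem killing_cokernel_pointwise (U : ℝ³ → ℝ³) (g : ℝ → ℝ) (x : ℝ³)
    (hU : DifferentiableAt ℝ U x) (hg : DifferentiableAt ℝ g (swirl U x))
    (horth : fderiv ℝ (swirl U) x (U x) = 0) :
    -(fderiv ℝ (fun y => g (swirl U y) • rotField y) x) (U x)
        + ContinuousLinearMap.adjoint (fderiv ℝ U x) (g (swirl U x) • rotField x)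
      = g (swirl U x) • gradient (swirl U) x := by
  sorry

/-- Integrated form (note §2, (2.2)): for `U ∈ C¹_c` with transported, axisymmetric swirl,
`W ∈ C¹` divergence free and `q ∈ C¹`, the pairing of `U·∇W + W·∇U + ∇q` with `g(Γ)·R`
vanishes (`g 0 = 0` makes the test field compactly supported). Whole-space IBP. -/
theorem killing_cokernel (U W : ℝ³ → ℝ³) (q : ℝ³ → ℝ) (g : ℝ → ℝ)
    (hU : ContDiff ℝ 1 U) (hUc : HasCompactSupport U) (hW : ContDiff ℝ 1 W) (hq : ContDiff ℝ 1 q)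
    (hdivW : VectorCalculus.IsDivFree W) (hg : ContDiff ℝ 1 g) (hg0 : g 0 = 0)
    (hΓ : IsAxisymmetricScalar (swirl U)) (horth : ∀ x, fderiv ℝ (swirl U) x (U x) = 0) :
    ∫ x, ⟪convect U W x + convect W U x + gradient q x, g (swirl U x) • rotField x⟫ = 0 := by
  sorry

/-- NECESSARY CONDITION (note §§2–3): a corrector around an AXISYMMETRIC profile balances the
swirl on every swirl level: `∫ g(Γ) ⟪R, ΔU − aU + b(y·∇)U + (c·∇)U⟫ = 0` for every `C¹`
weight with `g 0 = 0`. (Steady axisymmetric Euler gives `U·∇Γ = 0`; then `killing_cokernel`.) -/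
theorem corrector_swirl_balance (U W : ℝ³ → ℝ³) (P q : ℝ³ → ℝ) (a b : ℝ) (c : ℝ³)
    (h : CorrectorData U W P q a b c) (hax : IsAxisymmetric U)
    (g : ℝ → ℝ) (hg : ContDiff ℝ 1 g) (hg0 : g 0 = 0) :
    ∫ x, g (swirl U x) * ⟪rotField x, correctorRHS U a b c x⟫ = 0 := by
  sorry

/-- THE TARGET NEGATIVE LEMMA (note §1; proved there for tame outer collars, all `a b c`):
no axisymmetric profile carries a corrector. Candidate `CorrectorSolvable_false_without_…`
for the disprover's `Disproof.lean`. -/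
def NoAxisymmetricCorrector : Prop :=
  ∀ (U W : ℝ³ → ℝ³) (P q : ℝ³ → ℝ) (a b : ℝ) (c : ℝ³), IsAxisymmetric U → ¬ CorrectorData U W P q a b c

/-- What the negative lemma leaves of the crux: every witness is non-axisymmetric (about the
`x 2`-axis; (★) is isometry-equivariant — translations shift `c` by `b·x₀`, rotations rotate `c` —
so about any axis). -/
theorem correctorSolvable_witness_not_axisymmetric (h : NoAxisymmetricCorrector)
    (hC : Theses.AdiabaticEddy.CorrectorSolvable) :
    ∃ (U W : ℝ³ → ℝ³) (P q : ℝ³ → ℝ) (a b : ℝ) (c : ℝ³),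
      CorrectorData U W P q a b c ∧ ¬ IsAxisymmetric U := by
  obtain ⟨U, W, P, q, a, b, c, hd⟩ := hC
  exact ⟨U, W, P, q, a, b, c, hd, fun hax => h U W P q a b c hax hd⟩

/-- In particular Gavrilov's flows (the tree's whole supply, `IsAxisymmetric` recorded in the
fact) are never witnesses. -/
theorem gavrilov_not_witness (h : NoAxisymmetricCorrector) (hG : gavrilov_compact_steady_euler)
    (R δ : ℝ) (hR : 0 < R) (hδ : 0 < δ) :
    ∃ (U : ℝ³ → ℝ³) (P : ℝ³ → ℝ), ContDiff ℝ (⊤ : ℕ∞) U ∧ HasCompactSupport U ∧ U ≠ 0 ∧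
      IsAxisymmetric U ∧ (∀ x, convect U U x + gradient P x = 0) ∧
      ∀ (W : ℝ³ → ℝ³) (q : ℝ³ → ℝ) (a b : ℝ) (c : ℝ³), ¬ CorrectorData U W P q a b c := by
  obtain ⟨U, P, hU, -, hUc, -, hU0, -, hax, -, -, -, hE, -⟩ := hG R hR δ hδ
  exact ⟨U, P, hU, hUc, hU0, hax, hE, fun W q a b c hd => h U W P q a b c hax hd⟩

/-! ### Idea card `killing-free-collar`: the transfer target -/

/-- K1 of the card (an OPEN existence statement, Grad-conjecture territory): a nonzero `C^∞`
compactly supported steady Euler flow on `ℝ³` no isometric image of which is axisymmetric. -/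
def NonAxisymmetricCompactEuler : Prop :=
  ∃ (U : ℝ³ → ℝ³) (P : ℝ³ → ℝ), ContDiff ℝ (⊤ : ℕ∞) U ∧ ContDiff ℝ (⊤ : ℕ∞) P ∧
    HasCompactSupport U ∧ U ≠ 0 ∧ VectorCalculus.IsDivFree U ∧
    (∀ x, convect U U x + gradient P x = 0) ∧
    ∀ (e : ℝ³ ≃ₗᵢ[ℝ] ℝ³) (v : ℝ³), ¬ IsAxisymmetric (fun x => e.symm (U (e x + v)))

/-- The card's stronger form C⁺ of the crux: a corrector datum whose profile is Killing-free
(non-axisymmetric up to isometry). `C⁺ → CorrectorSolvable` is the trivial stub below; the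
negative lemma says the converse restriction loses nothing. -/
def KillingFreeCorrector : Prop :=
  ∃ (U W : ℝ³ → ℝ³) (P q : ℝ³ → ℝ) (a b : ℝ) (c : ℝ³), CorrectorData U W P q a b c ∧
    ∀ (e : ℝ³ ≃ₗᵢ[ℝ] ℝ³) (v : ℝ³), ¬ IsAxisymmetric (fun x => e.symm (U (e x + v)))

theorem correctorSolvable_of_killingFree (h : KillingFreeCorrector) :
    Theses.AdiabaticEddy.CorrectorSolvable := by
  obtain ⟨U, W, P, q, a, b, c, hd, -⟩ := h
  exact ⟨U, W, P, q, a, b, c, hd⟩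

end Summit.NavierStokesRegularity.NavierStokesRegularity.Cruxes.CorrectorSolvable.Ideator2
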